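import Summits.RiemannHypothesis.RiemannHypothesis.Theorems.GroundBartaEvenWinsBeyondArchDeflationPanelQLoc3
import HarnessLib

/-!
# RiemannHypothesis / GroundBarta — rung 4 (`EvenWinsBeyondArch`, stmt-RiemannHypothesis-18807 / 18085):
# the deflated Temple L-side, XIX b′ (part 4) — the H-part of a bulk panel in three proven-equal literals (kernel chunking)

Helper file (`--supports stmt-RiemannHypothesis-18807`), RH-free, no facts.  Prover B, speedrun unit `sr-gb-rung-b` (gen 4).
At `Dl = 32` with ρ-panel degrees up to 42 the H-part of an outer bulk panel (≈ 2k contraction panels + a high-degree near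
partial) exceeds one kernel `decide`; it is the definitional sum `fold − near + far` (`dt_archHTM_split`, `rfl`), so the
three pieces enter as literals with their own equations.  Pure unfolding of parts 1–3.
-/

set_option linter.dupNamespace false

noncomputable section

open MeasureTheory Set Filter intervalIntegral
open scoped Topology BigOperators

namespace Summit.RiemannHypothesis.RiemannHypothesis.Theorems.EvenWinsBeyondArch

open Literature.NumberTheory.LFunctions
open Literature.Analysis.ValidatedNumerics Literature.Analysis.ValidatedNumerics.PolyMP
  Literature.Analysis.ValidatedNumerics.NumericsMP Literature.Analysis.ValidatedNumerics.ExpPoly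

section PanelQ4

variable {S : ℕ} {c : ℚ} {m Dl k : ℕ}

/-- The contraction fold of the H-part (full panels `jn ≤ i < jf`). -/
def dt_archHfoldTM (S : ℕ) (m k : ℕ) (Gy : IPoly) (tab : ℤ → IPoly × ℤ × ℤ) (mu : ℕ → List MI) : IPoly :=
  let jn := m - 1 - k
  let jf := m + k
  let m0 : ℕ → MI := fun i ↦ (mu i).getD 0 default
  let contrW : ℤ → ℕ → ℤ → IPoly := fun n i sgn ↦
    widen0 (contrI S (tab n).1 (mu i) sgn) ⌈(((tab n).2.1 * (m0 i).hi : ℤ) : ℚ) / S⌉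
  (List.range jf).foldl (fun acc i ↦ if jn ≤ i then
      taddI acc (tsubI (tsmulI S (m0 i) Gy) (contrW ((k : ℤ) - i) i (-1))) else acc) []

/-- The near partial piece of the H-part (panel `jn`). -/
def dt_archHnearTM (S : ℕ) (c : ℚ) (m k Dl : ℕ) (Gy : IPoly) (tab : ℤ → IPoly × ℤ × ℤ) (mu : ℕ → List MI)
    (W : ℕ → IPoly) (pw : ℕ → Poly) : IPoly :=
  let h : ℚ := c / (2 * m)
  let jn := m - 1 - k
  let m0 : ℕ → MI := fun i ↦ (mu i).getD 0 default
  let partVarW : ℤ → ℕ → ℤ → ℤ → IPoly := fun n i sgn τ ↦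
    widen0 (partVarI S h (tab n).1 (pw i) sgn τ)
      ⌈((((tab n).2.1 * (m0 i).hi : ℤ) : ℚ) +
        2 * h * ((tabsI S h (tsubI (W i) (ratPolyI S (pw i))) * (tab n).2.2 : ℤ) : ℚ)) / S⌉
  tsubI (tmulI S h Dl Gy (partConstI S h (W jn) (pw jn) (-1))) (partVarW ((k : ℤ) - jn) jn (-1) (-1))

/-- The far partial piece of the H-part (panel `jf`). -/
def dt_archHfarTM (S : ℕ) (c : ℚ) (m k Dl : ℕ) (Gy : IPoly) (tab : ℤ → IPoly × ℤ × ℤ) (mu : ℕ → List MI)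
    (W : ℕ → IPoly) (pw : ℕ → Poly) : IPoly :=
  let h : ℚ := c / (2 * m)
  let jf := m + k
  let m0 : ℕ → MI := fun i ↦ (mu i).getD 0 default
  let partVarW : ℤ → ℕ → ℤ → ℤ → IPoly := fun n i sgn τ ↦
    widen0 (partVarI S h (tab n).1 (pw i) sgn τ)
      ⌈((((tab n).2.1 * (m0 i).hi : ℤ) : ℚ) +
        2 * h * ((tabsI S h (tsubI (W i) (ratPolyI S (pw i))) * (tab n).2.2 : ℤ) : ℚ)) / S⌉
  tsubI (tmulI S h Dl Gy (partConstI S h (W jf) (pw jf) 1)) (partVarW ((k : ℤ) - jf) jf (-1) 1)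

/-- `H = fold − near + far` (definitional). -/
theorem dt_archHTM_split (S : ℕ) (c : ℚ) (m k Dl : ℕ) (Gy : IPoly) (tab : ℤ → IPoly × ℤ × ℤ) (mu : ℕ → List MI)
    (W : ℕ → IPoly) (pw : ℕ → Poly) :
    dt_archHTM S c m k Dl Gy tab mu W pw =
      taddI (tsubI (dt_archHfoldTM S m k Gy tab mu) (dt_archHnearTM S c m k Dl Gy tab mu W pw))
        (dt_archHfarTM S c m k Dl Gy tab mu W pw) := rfl

/-- **Bulk panel, fully chunked** (E, H-fold, H-near, H-far as literals). [cite: Bombieri2000Weil, Thm 2] -/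
theorem dt_panelQL_bulk'' (hS : 0 < S) (hc : 0 < c) (W : dt_WinL S c m Dl) (hh1 : 2 * (c / (2 * m)) ≤ 1)
    (gp : Fin k → Poly) (Mt : ℚ) (Wt : Fin k → Fin k → ℚ) (i : Fin k) (V : dt_VecL S c m Dl (gp i)) {j : ℕ}
    (hjm : j + 2 ≤ m) {K : ℕ} (hK : 0 < K) {Ke ke : ℕ} {f1 f2 f3 : Bool × Bool}
    (hchk : dt_bulkCheckL S c m Dl W (gp i) j Ke ke f1 f2 f3 = true)
    (hRi : IntervalIntegrable (fun ρ ↦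
      dt_windowResidual (c : ℝ) gp W.w1 W.L1 W.w2 W.L2 W.w3 W.L3 (Mt : ℝ) (fun a l ↦ (Wt a l : ℝ)) i
        (((PolyMP.panelCentre (c / (2 * m)) j : ℚ) : ℝ) + ρ) ^ 2) volume (-((c / (2 * m) : ℚ) : ℝ)) ((c / (2 * m) : ℚ) : ℝ))
    {Etm F N R : IPoly} (hE : dt_archETM S c m j Dl (dt_locI S (gp i) (ofRat S (PolyMP.panelCentre (c / (2 * m)) j))) W.M0 (ttruncI S (c / (2 * m)) Dl (dt_locI S (gp i) (ofRat S (PolyMP.panelCentre (c / (2 * m)) j)))) V.tabF W.muF (fun i ↦ (W.Dρ.getD i default).1) (fun i ↦ (W.Dρ.getD i default).2) = Etm)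
    (hF : dt_archHfoldTM S m j (ttruncI S (c / (2 * m)) Dl (dt_locI S (gp i) (ofRat S (PolyMP.panelCentre (c / (2 * m)) j)))) V.tabF W.muF = F) (hN : dt_archHnearTM S c m j Dl (ttruncI S (c / (2 * m)) Dl (dt_locI S (gp i) (ofRat S (PolyMP.panelCentre (c / (2 * m)) j)))) V.tabF W.muF (fun i ↦ (W.Dρ.getD i default).1) (fun i ↦ (W.Dρ.getD i default).2) = N)
    (hR : dt_archHfarTM S c m j Dl (ttruncI S (c / (2 * m)) Dl (dt_locI S (gp i) (ofRat S (PolyMP.panelCentre (c / (2 * m)) j)))) V.tabF W.muF (fun i ↦ (W.Dρ.getD i default).1) (fun i ↦ (W.Dρ.getD i default).2) = R) (p : Poly) :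
    ∫ ρ in (-((c / (2 * m) : ℚ) : ℝ))..((c / (2 * m) : ℚ) : ℝ),
        dt_windowResidual (c : ℝ) gp W.w1 W.L1 W.w2 W.L2 W.w3 W.L3 (Mt : ℝ) (fun a l ↦ (Wt a l : ℝ)) i
          (((PolyMP.panelCentre (c / (2 * m)) j : ℚ) : ℝ) + ρ) ^ 2 ≤
      ((sqIntegUpperQ S (c / (2 * m)) (dt_panelLTM' S c m Dl K Ke ke W gp Mt Wt i V j f1 f2 f3 Etm (taddI (tsubI F N) R)) p : ℚ) : ℝ) := by
  subst hF; subst hN; subst hR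
  rw [← dt_archHTM_split]
  exact dt_panelQL_bulk' hS hc W hh1 gp Mt Wt i V hjm hK hchk hRi hE rfl p

/-- **Split panel, fully chunked.** [cite: Bombieri2000Weil, Thm 2] -/
theorem dt_panelQL_split'' (hS : 0 < S) (hc : 0 < c) (W : dt_WinL S c m Dl) (hh1 : 2 * (c / (2 * m)) ≤ 1)
    (gp : Fin k → Poly) (Mt : ℚ) (Wt : Fin k → Fin k → ℚ) (i : Fin k) (V : dt_VecL S c m Dl (gp i)) {j : ℕ}
    (hjm : j + 2 ≤ m) {K : ℕ} (hK : 0 < K) {Ke ke : ℕ} (f1 f2 f3 f1' f2' f3' : Bool × Bool) {β : ℝ} {bm bp : ℚ}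
    (hchk : dt_splitCheckL S c m W.M0.length (gp i) j Ke ke bm bp = true) (hbmβ : (bm : ℝ) ≤ β) (hβbp : β ≤ bp)
    (hflA : ∀ ρ : ℝ, -((c / (2 * m) : ℚ) : ℝ) < ρ → ρ < β →
      (f1.1 = true ↔ (((PolyMP.panelCentre (c / (2 * m)) j : ℚ) : ℝ) + ρ) - W.L1 ∈ Icc (-(c : ℝ)) c) ∧
      (f1.2 = true ↔ (((PolyMP.panelCentre (c / (2 * m)) j : ℚ) : ℝ) + ρ) + W.L1 ∈ Icc (-(c : ℝ)) c) ∧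
      (f2.1 = true ↔ (((PolyMP.panelCentre (c / (2 * m)) j : ℚ) : ℝ) + ρ) - W.L2 ∈ Icc (-(c : ℝ)) c) ∧
      (f2.2 = true ↔ (((PolyMP.panelCentre (c / (2 * m)) j : ℚ) : ℝ) + ρ) + W.L2 ∈ Icc (-(c : ℝ)) c) ∧
      (f3.1 = true ↔ (((PolyMP.panelCentre (c / (2 * m)) j : ℚ) : ℝ) + ρ) - W.L3 ∈ Icc (-(c : ℝ)) c) ∧
      (f3.2 = true ↔ (((PolyMP.panelCentre (c / (2 * m)) j : ℚ) : ℝ) + ρ) + W.L3 ∈ Icc (-(c : ℝ)) c))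
    (hflB : ∀ ρ : ℝ, β < ρ → ρ < ((c / (2 * m) : ℚ) : ℝ) →
      (f1'.1 = true ↔ (((PolyMP.panelCentre (c / (2 * m)) j : ℚ) : ℝ) + ρ) - W.L1 ∈ Icc (-(c : ℝ)) c) ∧
      (f1'.2 = true ↔ (((PolyMP.panelCentre (c / (2 * m)) j : ℚ) : ℝ) + ρ) + W.L1 ∈ Icc (-(c : ℝ)) c) ∧
      (f2'.1 = true ↔ (((PolyMP.panelCentre (c / (2 * m)) j : ℚ) : ℝ) + ρ) - W.L2 ∈ Icc (-(c : ℝ)) c) ∧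
      (f2'.2 = true ↔ (((PolyMP.panelCentre (c / (2 * m)) j : ℚ) : ℝ) + ρ) + W.L2 ∈ Icc (-(c : ℝ)) c) ∧
      (f3'.1 = true ↔ (((PolyMP.panelCentre (c / (2 * m)) j : ℚ) : ℝ) + ρ) - W.L3 ∈ Icc (-(c : ℝ)) c) ∧
      (f3'.2 = true ↔ (((PolyMP.panelCentre (c / (2 * m)) j : ℚ) : ℝ) + ρ) + W.L3 ∈ Icc (-(c : ℝ)) c))
    (hRi : IntervalIntegrable (fun ρ ↦
      dt_windowResidual (c : ℝ) gp W.w1 W.L1 W.w2 W.L2 W.w3 W.L3 (Mt : ℝ) (fun a l ↦ (Wt a l : ℝ)) i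
        (((PolyMP.panelCentre (c / (2 * m)) j : ℚ) : ℝ) + ρ) ^ 2) volume (-((c / (2 * m) : ℚ) : ℝ)) ((c / (2 * m) : ℚ) : ℝ))
    {Etm F N R : IPoly} (hE : dt_archETM S c m j Dl (dt_locI S (gp i) (ofRat S (PolyMP.panelCentre (c / (2 * m)) j))) W.M0 (ttruncI S (c / (2 * m)) Dl (dt_locI S (gp i) (ofRat S (PolyMP.panelCentre (c / (2 * m)) j)))) V.tabF W.muF (fun i ↦ (W.Dρ.getD i default).1) (fun i ↦ (W.Dρ.getD i default).2) = Etm)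
    (hF : dt_archHfoldTM S m j (ttruncI S (c / (2 * m)) Dl (dt_locI S (gp i) (ofRat S (PolyMP.panelCentre (c / (2 * m)) j)))) V.tabF W.muF = F) (hN : dt_archHnearTM S c m j Dl (ttruncI S (c / (2 * m)) Dl (dt_locI S (gp i) (ofRat S (PolyMP.panelCentre (c / (2 * m)) j)))) V.tabF W.muF (fun i ↦ (W.Dρ.getD i default).1) (fun i ↦ (W.Dρ.getD i default).2) = N)
    (hR : dt_archHfarTM S c m j Dl (ttruncI S (c / (2 * m)) Dl (dt_locI S (gp i) (ofRat S (PolyMP.panelCentre (c / (2 * m)) j)))) V.tabF W.muF (fun i ↦ (W.Dρ.getD i default).1) (fun i ↦ (W.Dρ.getD i default).2) = R) (pA pB : Poly) :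
    ∫ ρ in (-((c / (2 * m) : ℚ) : ℝ))..((c / (2 * m) : ℚ) : ℝ),
        dt_windowResidual (c : ℝ) gp W.w1 W.L1 W.w2 W.L2 W.w3 W.L3 (Mt : ℝ) (fun a l ↦ (Wt a l : ℝ)) i
          (((PolyMP.panelCentre (c / (2 * m)) j : ℚ) : ℝ) + ρ) ^ 2 ≤
      ((sqIntegSubLocQ S (c / (2 * m)) (dt_panelLTM' S c m Dl K Ke ke W gp Mt Wt i V j f1 f2 f3 Etm (taddI (tsubI F N) R)) pA
          (-(c / (2 * m))) bp : ℚ) : ℝ) +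
        ((sqIntegSubLocQ S (c / (2 * m)) (dt_panelLTM' S c m Dl K Ke ke W gp Mt Wt i V j f1' f2' f3' Etm (taddI (tsubI F N) R)) pB
          bm (c / (2 * m)) : ℚ) : ℝ) := by
  subst hF; subst hN; subst hR
  rw [← dt_archHTM_split]
  exact dt_panelQL_split' hS hc W hh1 gp Mt Wt i V hjm hK f1 f2 f3 f1' f2' f3' hchk hbmβ hβbp hflA hflB hRi hE rfl pA pB

end PanelQ4

end Summit.RiemannHypothesis.RiemannHypothesis.Theorems.EvenWinsBeyondArch

end
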